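import Mathlib

/-!
# The elementary residual `HypU` of THEOREM D6 — definitions `tau`, `HypU`, `URange`, `UTail` (`HodgeFermat/HypUDefs.lean`; HF-G23d)

Tree copy (whole module) of the module `HodgeFermat/HypUDefs.lean` of the sibling cell's standalone package
`run/shared/lean/pub/pub-hodgefermat/lean/HodgeFermat/` (62 lines, sha256 `fc216b351cbcb50f…`), source lines 24–62 (all: `tau`, `HypU`, `URange`, `UTail`, the combinators).
Filed by cell `pub-hfermat`, seat prover-1 gen-2, on the COORDINATOR KEEPER RULING of 2026-08-25 (gem sweep H1: take the
off-gate kernel theorem `thmFstar` through the gate) — here its second namesake, `HodgeFermat/ThmFstarNFinal.lean:29`,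
THEOREM F*(3N) at every admissible squarefree level (the first, `DecodingFinal.thmFstar` = THEOREM F* at the prime levels,
landed on 2026-08-25 as `HodgeFermatThmFstar.lean`, seat prover-1 gen-0); this file is one link of the import closure of
`ThmFstarNFinal.thmFstar` on top of that landed chain.  The source module's declarations are VERBATIM those of the cell record
`check/ThmFstarN_standalone.lean` (21 bodies, 438 871 B, sha256 ced731ec52c92191…, hub `lean check` rc 0, 222.2 s, `--axioms …ThmFstarN.thmFstarN` = [propext, Classical.choice, Quot.sound]; pub-hodgefermat `CERT.md` l.987, GATE HF-G33).
Deviations from the source module, exhaustively: the `import` lines (tree modules `Summits.HodgeConjecture.FermatCycles.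
HodgeFermat*` instead of `HodgeFermat.*`); this module docstring; one-line docstrings added (gate lint) to `uRange_append`, `uRange_mono`.  (Filed because the certificate checker `HypUCert`/`HypUAuto`, re-used by HYPOTHESIS V's kernel walk `HypVCert`, is stated over these constants; HYPOTHESIS U itself is not used by THEOREM F*(3N).)
Every other line — in particular every declaration's statement and proof — is byte-identical to the source.
HONEST FRAMING: explicit algebraic cycles for specific Hodge classes on Fermat/Delsarte varieties; residual open instances
listed; no claim on general Hodge.  (This file is arithmetic of CM types / of `(ℤ/N)ˣ`; it claims nothing about cycles.)

The source module's docstring (HypUDefs.lean l.6–22), verbatim: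

## The elementary residual `HypU` of THEOREM D6 — definitions only (HF-G23d)

This module holds the DEFINITIONS of `tau`, `HypU` (moved here verbatim from `HypBReduction.lean`, same
namespace, so every name downstream is unchanged) together with the range / tail forms `URange`, `UTail`
and the two-line combinators `uRange_append`, `hypU_of_range_tail`.  It imports only Mathlib, so that the
kernel certificate files `HypUCert.lean` / `HypUFinite*.lean` (which decide `URange a b` for finite ranges by
`decide +kernel`) share these constants with the analytic chain
(`HypBReduction.lean` → `HurwitzZero.lean`: `theoremD6_of_U : HypU → D6`) WITHOUT importing it — the hub
`lean check` takes one file of at most ~500 KB, and the chain alone is 360 KB.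

* `tau N p` : `0` if `-1` is a power of `p` modulo `N / p`, else `φ(N/p) / ord_{N/p}(p)`;
* `HypU`    : `∀ N > 1` squarefree prime to `6`, `6 * ∑ p ∈ N.primeFactors, tau N p < φ(N)`
              (`= U(N) < 1/6` of LEMMA S, `tables/SEMI-THEOREM.md` §2);
* `URange a b` : the same inequality for `a ≤ N < b`;  `UTail X` : the same for `N > X`;
* `hypU_of_range_tail X : URange 2 (X + 1) → UTail X → HypU`.
-/

set_option autoImplicit false

namespace HodgeFermat.KRFree.HypBReduction

open Finset

open Classical in
/-- `τ(N, p)`: `0` if `-1` is a power of `p` modulo `N / p`, else `φ(N/p) / ord_{N/p}(p)`. -/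
noncomputable def tau (N p : ℕ) : ℕ :=
  if ∃ k : ℕ, ((p : ℕ) : ZMod (N / p)) ^ k = -1 then 0
  else (N / p).totient / orderOf ((p : ℕ) : ZMod (N / p))

/-- HYPOTHESIS U (elementary group theory + a finite computation; LEMMA S of `tables/SEMI-THEOREM.md`):
`6 · Σ_{p ∣ N} τ(N, p) < φ(N)` for every squarefree `N > 1` prime to `6`. -/
def HypU : Prop :=
  ∀ N, 1 < N → Squarefree N → ¬ 2 ∣ N → ¬ 3 ∣ N → 6 * ∑ p ∈ N.primeFactors, tau N p < N.totient

/-- The inequality of `HypU` at the levels `a ≤ N < b`. -/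
def URange (a b : ℕ) : Prop :=
  ∀ N, a ≤ N → N < b → 1 < N → Squarefree N → ¬ 2 ∣ N → ¬ 3 ∣ N →
    6 * ∑ p ∈ N.primeFactors, tau N p < N.totient

/-- The inequality of `HypU` at the levels `N > X` (the analytic tail when `X` is large). -/
def UTail (X : ℕ) : Prop :=
  ∀ N, X < N → Squarefree N → ¬ 2 ∣ N → ¬ 3 ∣ N → 6 * ∑ p ∈ N.primeFactors, tau N p < N.totient

/-- glue two adjacent ranges of the inequality of `HypU` -/
theorem uRange_append {a b c : ℕ} (h₁ : URange a b) (h₂ : URange b c) : URange a c :=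
  fun N ha hc h1 hsq h2 h3 =>
    if hb : N < b then h₁ N ha hb h1 hsq h2 h3 else h₂ N (Nat.le_of_not_lt hb) hc h1 hsq h2 h3

/-- shrink the upper end of a range -/
theorem uRange_mono {a b b' : ℕ} (h : URange a b) (hb : b' ≤ b) : URange a b' :=
  fun N ha hc h1 hsq h2 h3 => h N ha (lt_of_lt_of_le hc hb) h1 hsq h2 h3

/-- `HypU` from a finite range `[2, X]` and the tail `N > X`. -/
theorem hypU_of_range_tail (X : ℕ) (hr : URange 2 (X + 1)) (ht : UTail X) : HypU :=
  fun N h1 hsq h2 h3 =>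
    if hX : N ≤ X then hr N (by omega) (by omega) h1 hsq h2 h3 else ht N (by omega) hsq h2 h3

end HodgeFermat.KRFree.HypBReduction
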